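import Summits.HodgeConjecture.HodgeConjecture.Theorems.F0P6aRoofLegsFinImage
import HarnessLib
import HarnessLib.Audit.LibrarySuggestionsDenyListCruxes

/-!
# F0_P6a_RoofLegsFinImage — next ED. = SHIM (K6 L2 column re-home; pen LA2-plan (g5) PLAN «L2 cone RE-HOME» v1.4; ★ parts by LA2-p03 (g7) R0 — ★ p852919 LANDED; box LAref-D (g4) first ∕ LA-ref1 (g5) second; TEMPLATE by LA2-p03 (g7), DEAL 6 — the LEAD composes the K6 shim request, not L2)

Every declaration of the tree workfile `Lines/F0_P6a_RoofLegsFinImage.lean` (leaflet v4 (tree edition of record), sha16 1b47322c605b8671, 187 l., sorry-free, stub-free; 1 declarations = 1 theorems + 0 def-like: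
`exists_roofLeg_of_legs_kerRowsFin_image`)
now lives, byte for byte and under the SAME namespace `Summit.HodgeConjecture.HodgeConjecture.Cruxes.HLiu418.F0P6aLineSpecialisation`, in the ★ chain
★ `Theorems/F0P6aRoofLegsFinImage.lean` (p852919) (LAST part = plain stem; each part imports the previous); this module keeps its name so that its tree importers
(`Lines/F0_P6a_StubRHO1.lean`) and any by-name reader under `open …F0P6aLineSpecialisation` resolve unchanged through the import above.
It declares nothing.  No declaration was cut in the ★ twin (verbatim re-home) ⇒ nothing to alias.
ORDER NOTE: written in ONE request with the rest of the K6 L-cone shims on the LEAD՚s word after (K5-R) BUILT and after EVERY ★ part above is ACCEPTED (NO-CROSS-IMPORT: no environment may hold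
a `Lines/` ORIGINAL of this column together with its ★ twin); an importer smoke that reads «environment already contains …» before that request is BUILT is this order note,
not a defect.  Edition history stays in the line card `Lines/F0_P6a_RoofLegsFinImage.md` and in git; future changes are ★-side proposals on the `Theorems/` files.
HC_CM is proved only modulo the 7 printed citations (2 remaining named inputs: hLiu418 = stmt-HodgeConjecture-24832, h413 = stmt-HodgeConjecture-24833) until rung 0 closes; count-neutral (0 `sorry`, 0 socket, 0 declarations). -/
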